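import Literature.Barriers.QuantumFields.DiscreteSubgroupFreezing
import Summits.QuantumFields.YangMills.Theorems.IR.Negative.FixedMesh.Loop
import Summits.QuantumFields.YangMills.Theorems.TunedSequenceExists.Negative.Freezing

/-!
# Fixed-mesh negative for format T, part 5/6: planar lattice Stokes on flat lifts and S2 `torusLoopFreezing` (fixed-torus freezing)

Part of the fixed-mesh negative for format T of crux `IR` (stmt-QuantumFields-19354, registered cut `af-pincer-T`
sha16 0308f95ca6f6a115); headline module `Theorems/IR/Negative/TypShellCondFalseFixedMesh.lean` (statement, provenance,
reading).  Content re-homed verbatim from the crux workfile `Cruxes/IR/CruxIdea8FixedMesh.lean` (cruxidea-8 GEN 5,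
tree sha16 d880b42bb52976de) under the namespace `Summit.QuantumFields.YangMills.Cruxes.IR.FixedMesh`; sorry-free.
-/

set_option autoImplicit false

noncomputable section

open MeasureTheory Filter Topology
open Literature.MathematicalPhysics.QuantumLattice
open Literature.Probability.LatticeModels
open Summit.QuantumFields.YangMills.Cruxes.IR.Tempered (cellEdges windowCells regionEdges)
open Summit.QuantumFields.YangMills.Cruxes.IR.ShellTempered (windowCellsPlus)
open Summit.QuantumFields.YangMills.Cruxes.IR.OnsetFormats (TypShellCond shellCount OnsetMixingTypical)

namespace Summit.QuantumFields.YangMills.Cruxes.IR.FixedMesh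

section FixedMesh

open Literature.MathematicalPhysics.QuantumFieldTheory (wilsonMeasure GaugeConfig isProbabilityMeasure_wilsonMeasure
  measurable_torusLift gaugeTransform wilsonMeasure_map_gaugeTransform_holds wilsonAction)
open Summit.QuantumFields.YangMills.Theorems.TunedSequenceExists.Negative.Freezing (tendsto_integral_wilsonMeasure
  re_trace_le_of_mem_unitaryGroup re_trace_eq_of_wilsonAction_eq_zero plaquetteHolonomyZd_torusLift')

variable {G : Type} [Group G] [TopologicalSpace G] [IsTopologicalGroup G] [CompactSpace G]
  [SecondCountableTopology G] [MeasurableSpace G] [BorelSpace G]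
  {N : ℕ} (ρ : G →* Matrix (Fin N) (Fin N) ℂ)


/-! ### 4f⁺. Fixed-torus freezing — S2 PROVED (GEN 5 continuation): planar lattice Stokes + tree Laplace lemma

Zero Wilson action ⇒ every torus plaquette holonomy has `Re tr ρ = N` (tree
`Freezing.re_trace_eq_of_wilsonAction_eq_zero`) ⇒ `ρ(U_p) = 1` (unitary rigidity, below) ⇒ `U_p = 1` (`ρ` faithful)
⇒ the periodic lift is `(0,1)`-flat (tree `Freezing.plaquetteHolonomyZd_torusLift'`) ⇒ the rectangle loop
`col · staple = 1` (planar lattice Stokes: two inductions on transports, pure group algebra) ⇒ `W ∘ lift = 1` on the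
zero set; the tree's Laplace concentration `Freezing.tendsto_integral_wilsonMeasure` (fixed torus, `β → ∞`,
continuous observable constant on the zero set of the action) gives `E_β[W ∘ lift] → 1`. -/

/-- Straight transport `(0,s) → (A,s)` in direction `0` (the links at heights `0, …, A-1` of the line `x₁ = s`). -/
def upT (U : LGConfig 4 G) (s : ℤ) (A : ℕ) : G :=
  ((List.range A).map fun t : ℕ => U (site2 (t : ℤ) s, 0)).prod

/-- Straight transport `(t,0) → (t,M)` in direction `1` (the links `x₁ = 0, …, M-1` of the line at height `t`). -/
def rightT (U : LGConfig 4 G) (t : ℤ) (M : ℕ) : G :=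
  ((List.range M).map fun s : ℕ => U (site2 t (s : ℤ), 1)).prod

omit [TopologicalSpace G] [IsTopologicalGroup G] [CompactSpace G] [SecondCountableTopology G]
  [MeasurableSpace G] [BorelSpace G] in
/-- The empty vertical transport is `1`. -/
@[simp] theorem upT_zero (U : LGConfig 4 G) (s : ℤ) : upT U s 0 = 1 := by simp [upT]

omit [TopologicalSpace G] [IsTopologicalGroup G] [CompactSpace G] [SecondCountableTopology G]
  [MeasurableSpace G] [BorelSpace G] in
/-- The empty horizontal transport is `1`. -/
@[simp] theorem rightT_zero (U : LGConfig 4 G) (t : ℤ) : rightT U t 0 = 1 := by simp [rightT]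

omit [TopologicalSpace G] [IsTopologicalGroup G] [CompactSpace G] [SecondCountableTopology G]
  [MeasurableSpace G] [BorelSpace G] in
/-- One more link on the vertical transport. -/
theorem upT_succ (U : LGConfig 4 G) (s : ℤ) (A : ℕ) :
    upT U s (A + 1) = upT U s A * U (site2 (A : ℤ) s, 0) := by
  simp [upT, List.range_succ]

omit [TopologicalSpace G] [IsTopologicalGroup G] [CompactSpace G] [SecondCountableTopology G]
  [MeasurableSpace G] [BorelSpace G] in
/-- One more link on the horizontal transport. -/
theorem rightT_succ (U : LGConfig 4 G) (t : ℤ) (M : ℕ) :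
    rightT U t (M + 1) = rightT U t M * U (site2 t (M : ℤ), 1) := by
  simp [rightT, List.range_succ]

/-- `site2 t s + e_0 = site2 (t+1) s`. -/
theorem site2_add_single_zero (t s : ℤ) : site2 t s + Pi.single (0 : Fin 4) 1 = site2 (t + 1) s := by
  funext k
  fin_cases k <;> simp [site2]

/-- `site2 t s + e_1 = site2 t (s+1)`. -/
theorem site2_add_single_one (t s : ℤ) : site2 t s + Pi.single (1 : Fin 4) 1 = site2 t (s + 1) := by
  funext k
  fin_cases k <;> simp [site2]

/-- `(0,1)`-flatness of a `ℤ⁴` configuration on the coordinate plane through the origin: every plaquette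
holonomy `U_{(t,s;0,1)} = 1`. -/
def Flat01 (U : LGConfig 4 G) : Prop := ∀ t s : ℤ, plaquetteHolonomyZd U (site2 t s) 0 1 = 1

omit [TopologicalSpace G] [IsTopologicalGroup G] [CompactSpace G] [SecondCountableTopology G]
  [MeasurableSpace G] [BorelSpace G] in
/-- On a `(0,1)`-flat configuration the link above a plaquette is determined by the other three. -/
theorem Flat01.link {U : LGConfig 4 G} (hU : Flat01 U) (t s : ℤ) :
    U (site2 (t + 1) s, 1) = (U (site2 t s, 0))⁻¹ * U (site2 t s, 1) * U (site2 t (s + 1), 0) := by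
  have hf := hU t s
  rw [plaquetteHolonomyZd, site2_add_single_zero, site2_add_single_one] at hf
  calc U (site2 (t + 1) s, 1)
      = (U (site2 t s, 0))⁻¹ * (U (site2 t s, 0) * U (site2 (t + 1) s, 1) * (U (site2 t (s + 1), 0))⁻¹ *
          (U (site2 t s, 1))⁻¹) * U (site2 t s, 1) * U (site2 t (s + 1), 0) := by group
    _ = _ := by rw [hf]; group

omit [TopologicalSpace G] [IsTopologicalGroup G] [CompactSpace G] [SecondCountableTopology G]
  [MeasurableSpace G] [BorelSpace G] in
/-- Stokes for a one-plaquette-high strip `[0,A] × [M,M+1]` (induction on `A`). -/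
theorem strip_eq_one {U : LGConfig 4 G} (hU : Flat01 U) (M : ℕ) : ∀ A : ℕ,
    upT U M A * U (site2 (A : ℤ) M, 1) * (upT U ((M : ℤ) + 1) A)⁻¹ * (U (site2 0 (M : ℤ), 1))⁻¹ = 1 := by
  intro A
  induction A with
  | zero => simp
  | succ A ih =>
    rw [upT_succ, upT_succ]
    push_cast
    have h1 := hU.link (A : ℤ) (M : ℤ)
    have h2 : upT U (M : ℤ) A =
        U (site2 0 (M : ℤ), 1) * upT U ((M : ℤ) + 1) A * (U (site2 (A : ℤ) (M : ℤ), 1))⁻¹ := by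
      calc upT U (M : ℤ) A
          = (upT U M A * U (site2 (A : ℤ) M, 1) * (upT U ((M : ℤ) + 1) A)⁻¹ * (U (site2 0 (M : ℤ), 1))⁻¹) *
              (U (site2 0 (M : ℤ), 1) * upT U ((M : ℤ) + 1) A * (U (site2 (A : ℤ) (M : ℤ), 1))⁻¹) := by group
        _ = _ := by rw [ih]; group
    rw [h1, h2]
    group

omit [TopologicalSpace G] [IsTopologicalGroup G] [CompactSpace G] [SecondCountableTopology G]
  [MeasurableSpace G] [BorelSpace G] in
/-- **Planar lattice Stokes**: on a `(0,1)`-flat configuration the boundary holonomy of the rectangle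
`[0,A] × [0,M]` based at the origin is trivial (induction on `M`, strips glued along the left column). -/
theorem rect_eq_one {U : LGConfig 4 G} (hU : Flat01 U) (A : ℕ) : ∀ M : ℕ,
    upT U 0 A * rightT U (A : ℤ) M * (upT U (M : ℤ) A)⁻¹ * (rightT U 0 M)⁻¹ = 1 := by
  intro M
  induction M with
  | zero => simp
  | succ M ih =>
    rw [rightT_succ, rightT_succ]
    push_cast
    have hs := strip_eq_one hU M A
    have h1 : (upT U ((M : ℤ) + 1) A)⁻¹ =
        (U (site2 (A : ℤ) (M : ℤ), 1))⁻¹ * (upT U (M : ℤ) A)⁻¹ * U (site2 0 (M : ℤ), 1) := by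
      calc (upT U ((M : ℤ) + 1) A)⁻¹
          = (U (site2 (A : ℤ) (M : ℤ), 1))⁻¹ * (upT U (M : ℤ) A)⁻¹ *
              (upT U M A * U (site2 (A : ℤ) M, 1) * (upT U ((M : ℤ) + 1) A)⁻¹ * (U (site2 0 (M : ℤ), 1))⁻¹) *
              U (site2 0 (M : ℤ), 1) := by group
        _ = _ := by rw [hs]; group
    have h2 : upT U 0 A = rightT U 0 M * upT U (M : ℤ) A * (rightT U (A : ℤ) M)⁻¹ := by
      calc upT U 0 A = (upT U 0 A * rightT U (A : ℤ) M * (upT U (M : ℤ) A)⁻¹ * (rightT U 0 M)⁻¹) *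
            (rightT U 0 M * upT U (M : ℤ) A * (rightT U (A : ℤ) M)⁻¹) := by group
        _ = _ := by rw [ih]; group
    rw [h1, h2]
    group

omit [TopologicalSpace G] [IsTopologicalGroup G] [CompactSpace G] [SecondCountableTopology G]
  [MeasurableSpace G] [BorelSpace G] in
/-- The closing link times the column is the straight transport `(0,0) → (b+1,0)`. -/
theorem mul_col_eq_upT {b : ℕ} (hb : 1 ≤ b) (U : LGConfig 4 G) :
    U (site2 0 0, 0) * col b U = upT U 0 (b + 1) := by
  obtain ⟨b', rfl⟩ : ∃ b', b = b' + 1 := ⟨b - 1, by omega⟩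
  simp only [col, upT, Nat.add_sub_cancel, List.range_succ_eq_map, List.map_cons, List.map_map,
    List.prod_cons, Function.comp_def, Nat.succ_eq_add_one]
  push_cast
  simp only [add_assoc, one_add_one_eq_two]

omit [TopologicalSpace G] [IsTopologicalGroup G] [CompactSpace G] [SecondCountableTopology G]
  [MeasurableSpace G] [BorelSpace G] in
/-- The staple in transport form: top run, reversed right column, reversed bottom run, closing link. -/
theorem staple_eq_transport (b m : ℕ) (U : LGConfig 4 G) :
    staple b m U =
      rightT U ((b : ℤ) + 1) m * ((upT U (m : ℤ) (b + 1))⁻¹ * ((rightT U 0 m)⁻¹ * U (site2 0 0, 0))) := by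
  simp only [staple, rightT, upT, List.prod_inv_reverse, List.map_map, List.map_reverse, Function.comp_def]

omit [TopologicalSpace G] [IsTopologicalGroup G] [CompactSpace G] [SecondCountableTopology G]
  [MeasurableSpace G] [BorelSpace G] in
/-- **The rectangle loop is trivial on `(0,1)`-flat configurations** (`b ≥ 1`). -/
theorem col_mul_staple_eq_one {U : LGConfig 4 G} (hU : Flat01 U) {b : ℕ} (hb : 1 ≤ b) (m : ℕ) :
    col b U * staple b m U = 1 := by
  have hrect := rect_eq_one hU (b + 1) m
  push_cast at hrect
  rw [← mul_col_eq_upT hb U] at hrect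
  rw [staple_eq_transport]
  have hcol : col b U = (U (site2 0 0, 0))⁻¹ *
      (rightT U 0 m * upT U (m : ℤ) (b + 1) * (rightT U ((b : ℤ) + 1) m)⁻¹) := by
    calc col b U = (U (site2 0 0, 0))⁻¹ * (U (site2 0 0, 0) * col b U * rightT U ((b : ℤ) + 1) m *
          (upT U (m : ℤ) (b + 1))⁻¹ * (rightT U 0 m)⁻¹) *
          (rightT U 0 m * upT U (m : ℤ) (b + 1) * (rightT U ((b : ℤ) + 1) m)⁻¹) := by group
      _ = _ := by rw [hrect]; group
  rw [hcol]
  group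

omit [TopologicalSpace G] [IsTopologicalGroup G] [CompactSpace G] [SecondCountableTopology G]
  [MeasurableSpace G] [BorelSpace G] in
/-- **Zero action ⇒ the lifted rectangle loop is `1`.**  `S_W(V) = 0` ⇒ every torus plaquette has
`Re tr ρ(U_p) = N` ⇒ `ρ(U_p) = 1` ⇒ `U_p = 1` (`ρ` faithful) ⇒ the periodic lift is `(0,1)`-flat ⇒ Stokes. -/
theorem loopObs_torusLift_eq_one {L : ℕ} [NeZero L] (hρu : ∀ g, ρ g ∈ Matrix.unitaryGroup (Fin N) ℂ)
    (hρi : Function.Injective ρ) (hN : 1 ≤ N) {b : ℕ} (hb : 1 ≤ b) (m : ℕ) {V : GaugeConfig 4 L G}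
    (h0 : wilsonAction ρ V = 0) : loopObs ρ b m (torusLift L V) = 1 := by
  have hflat : Flat01 (torusLift L V) := by
    intro t s
    rw [plaquetteHolonomyZd_torusLift']
    have htr := re_trace_eq_of_wilsonAction_eq_zero ρ (fun g => re_trace_le_of_mem_unitaryGroup (hρu g)) h0
      (Torus.proj L (site2 t s)) 0 1 (by decide)
    exact hρi (by rw [Literature.Barriers.QuantumFields.eq_one_of_re_trace_eq (hρu _) htr, map_one])
  have h1 := col_mul_staple_eq_one hflat hb m
  have hN' : (N : ℂ) ≠ 0 := by exact_mod_cast (show N ≠ 0 by omega)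
  simp [loopObs, chargedTest, h1, Matrix.trace_one, hN']

/-- **S2 — fixed-torus freezing of the contractible rectangle loop (PROVED).**
On ONE torus of side `2S+1`, the Wilson state concentrates as `β → ∞` on the zero set of the Wilson action
(tree `Freezing.tendsto_integral_wilsonMeasure`: Laplace concentration for a continuous observable constant on the
zero set, via compactness and Haar open-positivity), where the lifted rectangle loop equals `1`
(`loopObs_torusLift_eq_one`).  Hence `E_β[W ∘ lift] → 1`, in particular `≥ θ` for every `θ < 1` and all large `β`. -/
theorem torusLoopFreezing (hρ : Continuous ρ) (hρi : Function.Injective ρ)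
    (hρu : ∀ g, ρ g ∈ Matrix.unitaryGroup (Fin N) ℂ) (hN : 1 ≤ N) {b : ℕ} (hb : 1 ≤ b) (m S : ℕ)
    {θ : ℝ} (hθ : θ < 1) :
    ∃ β₀ : ℝ, ∀ β : ℝ, β₀ ≤ β →
      θ ≤ ∫ V, loopObs ρ b m (torusLift (2 * S + 1) V) ∂(wilsonMeasure (d := 4) (L := 2 * S + 1) ρ β) := by
  have hρN : ∀ g, (ρ g).trace.re ≤ N := fun g => re_trace_le_of_mem_unitaryGroup (hρu g)
  have hF : Continuous fun V : GaugeConfig 4 (2 * S + 1) G => loopObs ρ b m (torusLift (2 * S + 1) V) :=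
    (continuous_loopObs ρ hρ b m).comp (continuous_torusLift _)
  have hlim := tendsto_integral_wilsonMeasure ρ hρ hρN hF (c := 1)
    (fun V hV => loopObs_torusLift_eq_one ρ hρu hρi hN hb m hV)
  obtain ⟨β₀, hβ₀⟩ := Filter.eventually_atTop.1 (hlim.eventually (eventually_gt_nhds hθ))
  exact ⟨β₀, fun β hβ => (hβ₀ β hβ).le⟩


end FixedMesh

end Summit.QuantumFields.YangMills.Cruxes.IR.FixedMesh

end
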